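import Summits.QuantumFields.YangMills.Theorems.FluctuationComparisonRegPrIntLS2BetaCornerInTube
import Summits.QuantumFields.YangMills.Theorems.FluctuationComparisonRegPrIntLS2BetaSignedCombSupLipschitz
import HarnessLib

/-!
# S2β · DET-REP (B) — (Q-TUBE) FOR AN ALIGNED PAIR, DEPTH-FREE: bondwise closeness of a COMB-ALIGNED residual translate of the corner's minimiser to the base,
# with NO comb-reach factor (px21 g17's DEPTH FLAG 21:11:54Z on ✓p788715 §5, cured by his algebra)

Cell `ym3-torus` (rung R3: continuum `SU(2)` Yang–Mills on `T³` — NOT `d = 4`, NOT infinite volume, NOT a mass gap, NOT Clay); seat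
`ymfull-r3-prover-4` g0 (R590-ym (a) item (4), DET-REP (B)); definition-free helper of the crux `stmt-QuantumFields-20520`
(`--supports … --as helper`, NOT a proof of it and NOT a proof of any registered stub).

WHY.  ✓p788715 `slice_of_bondwiseClose` turns a bondwise sup `M` into the (F6) window test at the price of the comb reach `(2·d·((Lᵏ−1)∕2)+1)`: depth-free for the
interior closeness `M_α = O(ε₀·L^{−k})` of ✓`UnitScaleTiltProp7AxialGaugeBlock.dist1_mul_inv_le_interior`, but NOT for the FACE closeness of
✓`UnitScaleTiltProp7AxialGaugeFace.dist1_mul_inv_le_face_T3` (`O(ε₀) + β`, px21 g17's LOCATE 21:11:54Z).  For an ALIGNED pair — `combTransporter k W = combTransporter k U₀`,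
which is what print's axial aligner ✓`Prop7AxialGauge.exists_axialGauge_T3` delivers once ✓∕⧗`…S2BetaCombTransporterAxialT` (px21, the `axialT ↔ combTransporter` bridge) is read —
the (F6) test quantity `(T₀(b₋)·U₀ b·T₀(b₊)⁻¹)⁻¹·(T₀(b₋)·W b·T₀(b₊)⁻¹)` is a CONJUGATE of `W b·U₀ b⁻¹`, so its `dist1` IS `dist1(W b·U₀ b⁻¹)` (`GaugeGroup.dist1_conj`): NO comb factor.
* ★★★ `slice_of_aligned_bondwiseClose` — (F6) displayed (`hF6`, px21's docked COVER row ∕ ✓`exists_tubeRows_cover`'s (F6′), token for token) + `hT : T_W = T_{U₀}` +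
  `hclose : ∀ b ∉ comb ∪ pivots, dist1 (W b·(U₀ b)⁻¹) ≤ t` + `t < r_C`, `t ≤ ½`, `2t < s_C∕2` ⟹ `∃ y ∈ UV, ∃ w, W = pivotAct ι (w, c ↦ W(ι c)·U₀(ι c)⁻¹) (σ y)`.
* ★★★ `qTube_of_aligned_gaugeAct` — the same for ANY fine field `u` with a residual translate `w' • u` that is aligned and close: `∃ k, ∃ y, y ∈ UV ∧ pivotAct ι k (σ y) = u`
  (group bookkeeping of ✓p788715 `qTube_of_bondwiseClose_gaugeAct`).
* ★★★ `cornerRows_text_of_alignedClose` — composed with ✓p784096 `cornerRows_text_of_pivotAct_eq`: the per-value corner rows of `EdgeRows` at `(X, y)`.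
NET: the EDGE third of `def DetRepB` at a non-base corner ⟸ **CLOSE-ALIGNED-MIN** «a residual translate of `u_X` with the SAME comb transporter as `u₀` is within `t` of `u₀` on
every free bond, `t < min(r_C, s_C∕4) = ¼·log(4∕3)`» — and CLOSE-ALIGNED-MIN ⟸ BY NAME {aligner ✓`exists_axialGauge_T3` + bridge ⧗`axialT_rootOf_eq_combTransporter` (px21),
interior ✓`dist1_mul_inv_le_interior` (`O(ε₀η)`), face ✓`dist1_mul_inv_le_face_T3` (`≤ 112.25(e_X+e₀) + β`, `L ≥ 7`), `β ≤ 2θ_J` by ✓∕⧗`…S2BetaOneBondMoveSmall` ((β3))} — ALL KINEMATIC,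
depth-free; smallness by the organ's `ε₁` and `γ₁`.

HONEST SCOPE.  Group∕chart algebra over landed letters; def-free; default heartbeats; proves nothing of CLOSE-ALIGNED-MIN's suppliers' composition, DET-REP (B), GAP♯, S2β or the
crux 20520; finite-volume∕conditional programme; `YM3TorusSU2` NOT proved; rung R3 = SU(2) YM₃ on T³ — NOT d = 4, NOT infinite volume, NOT a mass gap, NOT Clay; the Yang–Mills
mass gap is NOT proved.

References: [Balaban1985RegularSpaces] CMP 99 (1985) Lemma 1 (1.24)–(1.26) pp. 79–80; [Balaban1985Averaging] CMP 98 (1985) (8) p. 19; [Balaban1985Variational] CMP 102 (1985)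
Thm 1 (8)–(10) p. 279, (19) p. 281; [Helgason2000] Ch. I §1 Thm 1.14 p. 96.
-/

noncomputable section

open MeasureTheory Filter Topology Set Function Metric
open scoped Matrix.Norms.L2Operator
open Literature.MathematicalPhysics.QuantumFieldTheory.Balaban1983to89
open Literature.MathematicalPhysics.QuantumFieldTheory.Balaban1983to89.T3ContinuumYM3Torus
open Literature.MathematicalPhysics.QuantumFieldTheory.Balaban1983to89.HaarExponentialChart
open Literature.MathematicalPhysics.QuantumFieldTheory.Balaban1983to89.LogChartProduct
open Literature.MathematicalPhysics.QuantumFieldTheory.Balaban1983to89.T3UnitLawDensityEML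
open Literature.MathematicalPhysics.QuantumFieldTheory.Balaban1983to89.T3TiltDescent
open Literature.MathematicalPhysics.QuantumFieldTheory.Balaban1983to89.T3ConstrainedMinimiser (fibre)
open Literature.MathematicalPhysics.QuantumFieldTheory.Balaban1983to89.T4Continuum
open scoped Literature.MathematicalPhysics.QuantumFieldTheory.Balaban1983to89.T3OrbitAverage
open Summit.QuantumFields.YangMills.Theorems.FluctuationComparisonRegPrIntLWregChain (iterCentralBond iterCentralBond_injective)
open Summit.QuantumFields.YangMills.Theorems.FluctuationComparisonRegPrIntLWregGlue (WindowChart)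
open Summit.QuantumFields.YangMills.Theorems.FluctuationComparisonRegPrIntLS2BetaResidualSubgroup
open Summit.QuantumFields.YangMills.Theorems.FluctuationComparisonRegPrIntLS2BetaResidualGauge (gaugeAct_inv_gaugeAct)
open Summit.QuantumFields.YangMills.Theorems.FluctuationComparisonRegPrIntLS2BetaSignedComb (combTransporter)
open Summit.QuantumFields.YangMills.Theorems.FluctuationComparisonRegPrIntLS2BetaSignedCombKill (combSet)
open Summit.QuantumFields.YangMills.Theorems.FluctuationComparisonRegPrIntLS2BetaCornerInTube (cornerRows_text_of_pivotAct_eq)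
open Summit.QuantumFields.YangMills.Theorems.FluctuationComparisonRegPrIntLS2BetaSignedCombSupLipschitz (mem_window_half_of_dist1_le)

namespace Summit.QuantumFields.YangMills.Theorems.FluctuationComparisonRegPrIntLS2BetaQTubeOfAligned

variable (F : T3Family) {J K : ℕ} (hJK : J ≤ K)

/-- ★★★ **ON THE SLICE FROM ALIGNED BONDWISE CLOSENESS — NO COMB FACTOR.**  With the same comb transporter as the base (`hT`), the (F6) test quantity at a free bond is
`(T₀(b₊)·U₀ b⁻¹)·(W b·U₀ b⁻¹)·(T₀(b₊)·U₀ b⁻¹)⁻¹`, so its `dist1` is `dist1 (W b·U₀ b⁻¹) ≤ t` (`dist1_conj`), and ✓`mem_window_half_of_dist1_le` puts it in the half-window.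
[cite: Balaban1985RegularSpaces, Lemma 1 (1.25) p.79; Helgason2000, Ch. I §1 Thm 1.14 p.96] -/
theorem slice_of_aligned_bondwiseClose
    {dV : ℕ} {U₀ : GaugeField (F.P K) 0 (Matrix.specialUnitaryGroup (Fin 2) ℂ)}
    {σ : EuclideanSpace ℝ (Fin dV) → GaugeField (F.P K) 0 (Matrix.specialUnitaryGroup (Fin 2) ℂ)}
    {UV : Set (EuclideanSpace ℝ (Fin dV))}
    (hF6 : ∀ V' : GaugeField (F.P K) 0 (Matrix.specialUnitaryGroup (Fin 2) ℂ),
        (∀ (b : PBond (F.P K) 0) (hb : b ∉ (combSet (K - J) : Set (PBond (F.P K) 0)) ∪ Set.range (iterCentralBond (P := F.P K) (K - J))),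
          (combTransporter (K - J) U₀ b.src * U₀ b * (combTransporter (K - J) U₀ b.tgt)⁻¹)⁻¹ *
              (combTransporter (K - J) V' b.src * V' b * (combTransporter (K - J) V' b.tgt)⁻¹) ∈
            (isChartRep_specialUnitaryGroup (n := Fin 2)).window (IsChartRep.chartRadius (specialUnitaryLogChart (Fin 2)) / 2)) →
        ∃ y ∈ UV, ∃ w : residualSubgroup F hJK,
          (w : Site (F.P K) 0 → Matrix.specialUnitaryGroup (Fin 2) ℂ) = (fun x => (combTransporter (K - J) V' x)⁻¹ * combTransporter (K - J) U₀ x) ∧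
          V' = pivotAct F hJK (iterCentralBond (P := F.P K) (K - J))
            (w, fun c => V' (iterCentralBond (P := F.P K) (K - J) c) * (U₀ (iterCentralBond (P := F.P K) (K - J) c))⁻¹) (σ y))
    {W : GaugeField (F.P K) 0 (Matrix.specialUnitaryGroup (Fin 2) ℂ)} {t : ℝ}
    (hT : combTransporter (K - J) W = combTransporter (K - J) U₀)
    (hclose : ∀ (b : PBond (F.P K) 0), b ∉ (combSet (K - J) : Set (PBond (F.P K) 0)) ∪ Set.range (iterCentralBond (P := F.P K) (K - J)) →
      dist1 (W b * (U₀ b)⁻¹) ≤ t)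
    (ht₁ : t < IsChartRep.innerRadius (specialUnitaryLogChart (Fin 2))) (ht₂ : t ≤ 1 / 2)
    (ht₃ : 2 * t < IsChartRep.chartRadius (specialUnitaryLogChart (Fin 2)) / 2) :
    ∃ y ∈ UV, ∃ w : residualSubgroup F hJK,
      W = pivotAct F hJK (iterCentralBond (P := F.P K) (K - J))
        (w, fun c => W (iterCentralBond (P := F.P K) (K - J) c) * (U₀ (iterCentralBond (P := F.P K) (K - J) c))⁻¹) (σ y) := by
  obtain ⟨y, hy, w, -, hW⟩ := hF6 W fun b hb => by
    have hconj : (combTransporter (K - J) U₀ b.src * U₀ b * (combTransporter (K - J) U₀ b.tgt)⁻¹)⁻¹ *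
        (combTransporter (K - J) W b.src * W b * (combTransporter (K - J) W b.tgt)⁻¹) =
        (combTransporter (K - J) U₀ b.tgt * (U₀ b)⁻¹) * (W b * (U₀ b)⁻¹) * (combTransporter (K - J) U₀ b.tgt * (U₀ b)⁻¹)⁻¹ := by
      rw [hT]; group
    rw [hconj]
    refine mem_window_half_of_dist1_le _ ?_ ht₁ ht₂ ht₃
    rw [GaugeGroup.dist1_conj]
    exact hclose b hb
  exact ⟨y, hy, w, hW⟩

/-- ★★★ **(Q-TUBE) FROM CLOSE-ALIGNED-MIN**: if a residual translate `w' • u` of a fine field `u` has the base's comb transporter and is within `t` of the base on every free bond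
(`t` below the fixed chart thresholds), then `∃ k, ∃ y, y ∈ UV ∧ pivotAct ι k (σ y) = u` — the (Q-TUBE) letter of ✓p784096, DEPTH-FREE in its hypotheses.
[cite: Balaban1985RegularSpaces, Lemma 1 (1.25) p.79; Balaban1985Averaging, (8) p.19] -/
theorem qTube_of_aligned_gaugeAct (hk : K - J ≤ (F.P K).m + (F.P K).K)
    {dV : ℕ} {U₀ : GaugeField (F.P K) 0 (Matrix.specialUnitaryGroup (Fin 2) ℂ)}
    {σ : EuclideanSpace ℝ (Fin dV) → GaugeField (F.P K) 0 (Matrix.specialUnitaryGroup (Fin 2) ℂ)}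
    {UV : Set (EuclideanSpace ℝ (Fin dV))}
    (hF6 : ∀ V' : GaugeField (F.P K) 0 (Matrix.specialUnitaryGroup (Fin 2) ℂ),
        (∀ (b : PBond (F.P K) 0) (hb : b ∉ (combSet (K - J) : Set (PBond (F.P K) 0)) ∪ Set.range (iterCentralBond (P := F.P K) (K - J))),
          (combTransporter (K - J) U₀ b.src * U₀ b * (combTransporter (K - J) U₀ b.tgt)⁻¹)⁻¹ *
              (combTransporter (K - J) V' b.src * V' b * (combTransporter (K - J) V' b.tgt)⁻¹) ∈
            (isChartRep_specialUnitaryGroup (n := Fin 2)).window (IsChartRep.chartRadius (specialUnitaryLogChart (Fin 2)) / 2)) →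
        ∃ y ∈ UV, ∃ w : residualSubgroup F hJK,
          (w : Site (F.P K) 0 → Matrix.specialUnitaryGroup (Fin 2) ℂ) = (fun x => (combTransporter (K - J) V' x)⁻¹ * combTransporter (K - J) U₀ x) ∧
          V' = pivotAct F hJK (iterCentralBond (P := F.P K) (K - J))
            (w, fun c => V' (iterCentralBond (P := F.P K) (K - J) c) * (U₀ (iterCentralBond (P := F.P K) (K - J) c))⁻¹) (σ y))
    {u : GaugeField (F.P K) 0 (Matrix.specialUnitaryGroup (Fin 2) ℂ)} (w' : residualSubgroup F hJK) {t : ℝ}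
    (hT : combTransporter (K - J) (GaugeField.gaugeAct (w' : Site (F.P K) 0 → Matrix.specialUnitaryGroup (Fin 2) ℂ) u) = combTransporter (K - J) U₀)
    (hclose : ∀ (b : PBond (F.P K) 0), b ∉ (combSet (K - J) : Set (PBond (F.P K) 0)) ∪ Set.range (iterCentralBond (P := F.P K) (K - J)) →
      dist1 (GaugeField.gaugeAct (w' : Site (F.P K) 0 → Matrix.specialUnitaryGroup (Fin 2) ℂ) u b * (U₀ b)⁻¹) ≤ t)
    (ht₁ : t < IsChartRep.innerRadius (specialUnitaryLogChart (Fin 2))) (ht₂ : t ≤ 1 / 2)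
    (ht₃ : 2 * t < IsChartRep.chartRadius (specialUnitaryLogChart (Fin 2)) / 2) :
    ∃ (k : ↥(residualSubgroup F hJK) × (PBond (F.P K) (K - J) → Matrix.specialUnitaryGroup (Fin 2) ℂ)) (y : EuclideanSpace ℝ (Fin dV)),
      y ∈ UV ∧ pivotAct F hJK (iterCentralBond (P := F.P K) (K - J)) k (σ y) = u := by
  set W : GaugeField (F.P K) 0 (Matrix.specialUnitaryGroup (Fin 2) ℂ) :=
    GaugeField.gaugeAct (w' : Site (F.P K) 0 → Matrix.specialUnitaryGroup (Fin 2) ℂ) u with hWdef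
  obtain ⟨y, hy, w, hW⟩ := slice_of_aligned_bondwiseClose F hJK hF6 (W := W) hT hclose ht₁ ht₂ ht₃
  refine ⟨(w'⁻¹, fun c => u (iterCentralBond (P := F.P K) (K - J) c) * (W (iterCentralBond (P := F.P K) (K - J) c))⁻¹) *
      (w, fun c => W (iterCentralBond (P := F.P K) (K - J) c) * (U₀ (iterCentralBond (P := F.P K) (K - J) c))⁻¹), y, hy, ?_⟩
  rw [pivotAct_mul F hJK _ (iterCentralBond_injective (P := F.P K) hk), ← hW]
  funext b
  by_cases hb : ∃ c, iterCentralBond (P := F.P K) (K - J) c = b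
  · obtain ⟨c, rfl⟩ := hb
    rw [pivotAct_apply_pivot F hJK _ (iterCentralBond_injective (P := F.P K) hk)]
    show u _ * (W _)⁻¹ * W _ = u _
    rw [inv_mul_cancel_right]
  · rw [pivotAct_apply_of_not_mem_range F hJK _ _ _ hb]
    show GaugeField.gaugeAct (((w'⁻¹ : residualSubgroup F hJK)) : Site (F.P K) 0 → Matrix.specialUnitaryGroup (Fin 2) ℂ) W b = u b
    rw [Subgroup.coe_inv, hWdef, gaugeAct_inv_gaugeAct]

/-- ★★★ **THE CORNER ROWS FROM CLOSE-ALIGNED-MIN** (depth-free edition of ✓`…S2BetaCornerOfCloseBondMin.cornerRows_text_of_closeBondMin`): = ★★★`qTube_of_aligned_gaugeAct` then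
✓`cornerRows_text_of_pivotAct_eq`. [cite: Balaban1985Variational, Thm 1 (8)-(10) p.279; Balaban1985RegularSpaces, Lemma 1 (1.25) p.79; Balaban1985Averaging, §E Prop 6 p.26-27] -/
theorem cornerRows_text_of_alignedClose (hk : K - J ≤ (F.P K).m + (F.P K).K)
    {Sf : Set (GaugeField (F.P K) 0 (Matrix.specialUnitaryGroup (Fin 2) ℂ))} {O : Set (GaugeField (F.P J) 0 (Matrix.specialUnitaryGroup (Fin 2) ℂ))}
    (c : WindowChart F hJK Sf O) (m : GaugeField (F.P J) 0 (Matrix.specialUnitaryGroup (Fin 2) ℂ) → ℝ)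
    {X : GaugeField (F.P J) 0 (Matrix.specialUnitaryGroup (Fin 2) ℂ)} {u : GaugeField (F.P K) 0 (Matrix.specialUnitaryGroup (Fin 2) ℂ)}
    (hu : u ∈ fibre F ℰp J K hJK X ∧ u ∈ Sf ∧ wilsonAction4 u = m X)
    (hcarr : ∀ k z, z ∈ {z : GaugeField (F.P K) 0 (Matrix.specialUnitaryGroup (Fin 2) ℂ) | c.jac (X, z) ≠ 0} →
      pivotAct F hJK (iterCentralBond (P := F.P K) (K - J)) k z ∈ {z : GaugeField (F.P K) 0 (Matrix.specialUnitaryGroup (Fin 2) ℂ) | c.jac (X, z) ≠ 0})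
    (hAinv : ∀ k, ∀ z ∈ {z : GaugeField (F.P K) 0 (Matrix.specialUnitaryGroup (Fin 2) ℂ) | c.jac (X, z) ≠ 0},
      wilsonAction4 (c.Φ (X, pivotAct F hJK (iterCentralBond (P := F.P K) (K - J)) k z)) = wilsonAction4 (c.Φ (X, z)))
    (hSinv : ∀ k, ∀ z ∈ {z : GaugeField (F.P K) 0 (Matrix.specialUnitaryGroup (Fin 2) ℂ) | c.jac (X, z) ≠ 0},
      c.Φ (X, z) ∈ Sf → c.Φ (X, pivotAct F hJK (iterCentralBond (P := F.P K) (K - J)) k z) ∈ Sf)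
    (hrec : ∀ U, descendTo F ℰp J K hJK U = X → U ∈ Sf → (c.jac (X, U) ≠ 0 ∧ c.Φ (X, U) = U) ∧
      {z : GaugeField (F.P K) 0 (Matrix.specialUnitaryGroup (Fin 2) ℂ) | c.jac (X, z) ≠ 0} ∈ 𝓝 U)
    {dV : ℕ} {U₀ : GaugeField (F.P K) 0 (Matrix.specialUnitaryGroup (Fin 2) ℂ)}
    {σ : EuclideanSpace ℝ (Fin dV) → GaugeField (F.P K) 0 (Matrix.specialUnitaryGroup (Fin 2) ℂ)} (hσ : Continuous σ)
    {UV : Set (EuclideanSpace ℝ (Fin dV))} {jV : EuclideanSpace ℝ (Fin dV) → ℝ} (hjV : ∀ y ∈ UV, 0 < jV y)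
    (hF6 : ∀ V' : GaugeField (F.P K) 0 (Matrix.specialUnitaryGroup (Fin 2) ℂ),
        (∀ (b : PBond (F.P K) 0) (hb : b ∉ (combSet (K - J) : Set (PBond (F.P K) 0)) ∪ Set.range (iterCentralBond (P := F.P K) (K - J))),
          (combTransporter (K - J) U₀ b.src * U₀ b * (combTransporter (K - J) U₀ b.tgt)⁻¹)⁻¹ *
              (combTransporter (K - J) V' b.src * V' b * (combTransporter (K - J) V' b.tgt)⁻¹) ∈
            (isChartRep_specialUnitaryGroup (n := Fin 2)).window (IsChartRep.chartRadius (specialUnitaryLogChart (Fin 2)) / 2)) →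
        ∃ y ∈ UV, ∃ w : residualSubgroup F hJK,
          (w : Site (F.P K) 0 → Matrix.specialUnitaryGroup (Fin 2) ℂ) = (fun x => (combTransporter (K - J) V' x)⁻¹ * combTransporter (K - J) U₀ x) ∧
          V' = pivotAct F hJK (iterCentralBond (P := F.P K) (K - J))
            (w, fun c => V' (iterCentralBond (P := F.P K) (K - J) c) * (U₀ (iterCentralBond (P := F.P K) (K - J) c))⁻¹) (σ y))
    (w' : residualSubgroup F hJK) {t : ℝ}
    (hT : combTransporter (K - J) (GaugeField.gaugeAct (w' : Site (F.P K) 0 → Matrix.specialUnitaryGroup (Fin 2) ℂ) u) = combTransporter (K - J) U₀)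
    (hclose : ∀ (b : PBond (F.P K) 0), b ∉ (combSet (K - J) : Set (PBond (F.P K) 0)) ∪ Set.range (iterCentralBond (P := F.P K) (K - J)) →
      dist1 (GaugeField.gaugeAct (w' : Site (F.P K) 0 → Matrix.specialUnitaryGroup (Fin 2) ℂ) u b * (U₀ b)⁻¹) ≤ t)
    (ht₁ : t < IsChartRep.innerRadius (specialUnitaryLogChart (Fin 2))) (ht₂ : t ≤ 1 / 2)
    (ht₃ : 2 * t < IsChartRep.chartRadius (specialUnitaryLogChart (Fin 2)) / 2) :
    ∃ y : EuclideanSpace ℝ (Fin dV),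
      y ∈ UV ∧ 0 < jV y ∧ (∀ᶠ v in 𝓝 y, c.jac (X, σ v) ≠ 0) ∧ c.Φ (X, σ y) ∈ Sf ∧ wilsonAction4 (c.Φ (X, σ y)) = m X := by
  obtain ⟨k, y, hy, hΘ⟩ := qTube_of_aligned_gaugeAct F hJK hk hF6 w' hT hclose ht₁ ht₂ ht₃
  exact ⟨y, cornerRows_text_of_pivotAct_eq F hJK hk c m hu hcarr hAinv hSinv hrec hσ hΘ hy (hjV y hy)⟩

end Summit.QuantumFields.YangMills.Theorems.FluctuationComparisonRegPrIntLS2BetaQTubeOfAligned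

end
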